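import Mathlib
import HarnessLib
import HarnessLib.Audit
import Summits.Schanuel.Statement
import Literature.Barriers.Schanuel.AlgebraicIndependenceOfLogarithms

/-!
Route: GeodesicLengthsGP3

CLOSED (retired) 2026-08-15T13:51:07Z by operator:999:1257524 — reason: not-a-thesis: assembly does not conclude the sub-problem Statement — note: D-0027 §2.1 audit (human 2026-08-15: routes that do not decide the summit are removed): the assembly concludes `(∀ (D C : ℚ), 0 < D → 0 < C → ∀ x : Fin 3 → ℝ, LinearIndependent ℚ x → (∀ i, IsAlgebraic ℚ (Real.exp (x i))) → x 0 ^ 2 + (D : ℝ) * x 1 ^ 2 ≠ (C : ℝ) * x 2 ^ 2) `, not the sub-problem state. The file is kept as the record of this route; refuted decls are indexed as negative knowledge (`ledger negatives`).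

# Route GeodesicLengthsGP3 — Hearing an arithmetic drum costs three real logs in geometric
progression; flats cost a log-lattice (P–R's Schanuel-dependence isolated at rank (2,1))

CONSUMER (sector) route realising card geodesic-lengths-pdq-gp3-v2. Prasad–Rapinchuk's theorems on
length-commensurable
arithmetically defined locally symmetric spaces (arXiv:1110.0141 Thm 1–5;
doi:10.1007/s10240-009-0019-6 §8) are conditional
on Schanuel, used only as algebraic independence of ℚ-independent real logarithms of algebraic
numbers (arXiv:1110.0141
Prop 7.1; arXiv:1307.1479 §6.3). Since λ_Γ(γ)² = Σ_α (log|α(γ)|)² is a positive-definite rational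
quadratic form in
ℚ-independent real logs, the first conditional case — a rank-2 space against a rank-1 space (single
logs) — needs exactly
X1 = PDQ21: for D, C ∈ ℚ_{>0} no ℚ-linearly independent triple (x, w, z) of real logarithms of
algebraic numbers satisfies
x² + D w² = C z². Compact 2-flats (Prasad–Raghunathan) amplify the hypothesis to a whole lattice of
lengths, which needs only
X2 = FlatLatticeLogs: for no μ > 0 and τ ∈ ℍ are all the numbers μ|m + nτ| ((m,n) ∈ ℤ²) logarithms
of algebraic numbers.
It suffices (for the geometric application at rank (2,1)) to show X = X1 ∧ X2; X does NOT imply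
Schanuel — Schanuel ⇒ X is
filed as support (SchanuelGivesTarget), so a refutation of any crux refutes the summit.
Lean: `(∀ (D C : ℚ), 0 < D → 0 < C → ∀ x : Fin 3 → ℝ, LinearIndependent ℚ x → (∀ i, IsAlgebraic ℚ
(Real.exp (x i))) → x 0 ^ 2 + (D : ℝ) * x 1 ^ 2 ≠ (C : ℝ) * x 2 ^ 2) ∧ (∀ (μ : ℝ) (τ : ℂ), 0 < μ → 0
< τ.im → ∃ m n : ℤ, ¬ IsAlgebraic ℚ (Real.exp (μ * ‖(m : ℂ) + (n : ℂ) * τ‖)))`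

## Assembly
Pure logic (sorry-free in the planner's Sketch.lean, `assembly_holds`): given D, C, split on whether
X² + DW² − CZ² has a
nontrivial rational zero; the isotropic case is IsotropicReduction applied to RealGP3, the
anisotropic case is AnisotropicPDQ21;
conjoin FlatLatticeLogs. The endpoint is the sector target X, not the summit: Schanuel ⇒ X
(SchanuelGivesTarget) is the link.

Rationale: WHY THIS LINE. Mechanism: read the transcendence input of a theorem in DIFFERENTIAL GEOMETRY off the
page and reduce it by the arithmetic
of quadratic forms. P–R themselves say only AlgIndepLogarithms is needed and that "there are no
results in transcendental number
theory that would enable one to analyze expressions of this kind" (arXiv:1307.1479 §6); the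
dictionary length² ↦ q_γ(a_γ)
(arXiv:1110.0141 eq. after Prop 7.1), ℚ·L = rational multiples, "not weakly contained" ↦
ℚ-independence turns
non-length-commensurability at rank (2,1) into PDQ21, and Hasse–Minkowski splits PDQ21: on a
ℚ-ISOTROPIC class the secant
parametrisation (det = −4DC) makes it EQUIVALENT to RealGP3 — no three ℚ-independent real logs in
geometric progression, the
real symmetric case [[λ₀,λ₁],[λ₁,λ₂]] of the four exponentials conjecture on Roy's no-go surface xy
= z² (Roy1995 §3.2),
equivalently "no Pythagorean triple of independent real logs" — while an ANISOTROPIC class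
parametrises over ℚ(√C) into a GP₃
in 𝓛 + √C·𝓛 ⊂ 𝓛̃, a case of the strong four exponentials conjecture (Waldschmidt2005 Conj 1.5). What
is already a theorem
rides as support: algebraic ratios die by Gelfond–Schneider (tree: gelfond_schneider_holds), length
4 by six exponentials
(six_exponentials_holds), ratios in 𝓛̃ by the strong six exponentials theorem (Waldschmidt2005 Cor
2.4), CM lattices by
Gelfond–Schneider; the residue is length 3 with transcendental ratio ∉ 𝓛̃, in the REAL case where
Diaz's complex-conjugation
results (Waldschmidt2005 Cor 2.7–2.9, 2.13) are void. The new lever is the flat (Prasad–Raghunathan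
doi:10.2307/1970790): a
compact 2-flat of M₁ contributes the full length set {‖k₁v₁+k₂v₂‖ : k ∈ ℤ²} of a flat torus, so
length-commensurability with
a space whose lengths are logs forces a LOG-LATTICE — infinitely many quadratic relations on three
parameters, the only
regime (cf. GP₄ vs GP₃) where six-exponentials-type technology has ever beaten a single quadratic
relation. Imports:
arithmetic groups / symmetric spaces (length formula, flats), quadratic forms over ℚ (isotropy,
Hilbert symbols), transcendence
(four/six exponentials, Roy's structural picture). No prior route on this summit has a consumer or a
degree-2 statement in the
𝓛-sector: AlgIndepMethod's rungs are (α^β)-ladders, RigidCore/EclCore/Zilber are model-theoretic,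
RoyCriterion is the
auxiliary-polynomial criterion.

RANKED CRUXES. #0 Target (target) — X = X1 ∧ X2 (PDQ21 ∧ FlatLatticeLogs) as in § Thesis: the
pointwise rank-(2,1) input and the flats-amplified input of the length-commensurability programme.
(why it might fail: X is a conjunction of open four-exponentials-type statements strictly below
AlgIndepLogarithms; it fails iff a rank-(2,1) length coincidence among independent real logs or a
log-lattice exists — either refutes Schanuel.) [arXiv:1110.0141, arXiv:1307.1479, Waldschmidt2005,
Roy1995]
#2 RealGP3 (crux) — no three ℚ-linearly independent real logarithms of (real, positive) algebraic
numbers are in geometric progression: x₁² ≠ x₀x₂ (card C1; equivalently PDQ21 on every ℚ-isotropic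
class, e.g. no Pythagorean triple (log α)² + (log β)² = (log γ)² of independent real logs). Roy's
no-go example xy = z² restricted to real points; the symmetric rank-one case of the four
exponentials conjecture. Algebraic ratio excluded by Gelfond–Schneider, ratio in 𝓛̃ by strong six
exponentials, length 4 by six exponentials (supports). [difficulty: open-problem] (why it might
fail: It is the symmetric rank-one case [[λ₀,λ₁],[λ₁,λ₂]] of the four exponentials conjecture on
Roy's no-go surface xy = z² (Roy1995 §3.2, Thm 3.4): no method known; false iff (log β)² = (log
α)(log γ) for multiplicatively independent real algebraic α, β, γ.) [Roy1995, Waldschmidt2005,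
doi:10.1007/s11139-015-9728-2, doi:10.5486/pmd.2007.3505, doi:10.1007/978-3-031-12244-6_39]
#3 FlatLatticeLogs (crux) — for every scale μ > 0 and every τ in the upper half plane some lattice
length μ|m + nτ| ((m,n) ∈ ℤ²) is not the logarithm of an algebraic number: no flat 2-torus has all
its closed-geodesic lengths in 𝓛 (card C2 'Q3C', flat form; via a compact 2-flat this alone forbids
length-commensurability of a rank-2 arithmetic quotient with any space whose lengths are rational
multiples of logs of algebraic numbers). CM lattices (τ imaginary quadratic) are excluded by
Gelfond–Schneider (support FlatLatticeCM); AlgIndepLogarithms ⇒ the statement (support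
SchanuelGivesTarget: five lengths k ∈ {(1,0),(0,1),(1,±1),(1,2)} already force a degenerate Gram
matrix). [difficulty: L] (why it might fail: Any finite set of lengths only obeys diagonal quadratic
relations (parallelogram law), each a 2×2 rank-one log matrix [[z₁−z₃, z₄−z₂],[z₄+z₂, z₁+z₃]] —
four-exponentials-hard; nothing in print exploits infinitely many such relations; only CM lattices
fall (Gelfond–Schneider).) [doi:10.2307/1970790, arXiv:1110.0141, Waldschmidt2005, Roy1995]
#4 AnisotropicPDQ21 (crux) — PDQ21 on the ℚ-ANISOTROPIC classes: if X² + D W² − C Z² (D, C ∈ ℚ_{>0})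
has no nontrivial rational zero, it has no zero (x, w, z) made of ℚ-linearly independent real
logarithms of algebraic numbers. By the planner's Hilbert-symbol computation (to be re-grounded) the
classes met by the basic geometric pairs are all of this kind: type A₂ vs A₁ gives ⟨1,3,−2⟩, B₂ vs
A₁ gives ⟨1,1,−3⟩, G₂ vs A₁ gives ⟨6,2,−1⟩, each anisotropic at p = 3. [deps: RealGP3] [difficulty:
open-problem] (why it might fail: Over ℚ(√C) the conic parametrises into a GP₃ inside 𝓛 + √C·𝓛 ⊂ 𝓛̃,
so this is a case of the STRONG four exponentials conjecture (Waldschmidt2005 Conj 1.5) on Roy's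
no-go surface, beyond even RealGP3; no partial result known for real entries.) [Waldschmidt2005,
Roy1995, arXiv:1110.0141, doi:10.3792/pjaa.71.151]
#9 IsotropicReduction (support) — RealGP3 ⇒ PDQ21 on every ℚ-isotropic class: a nontrivial rational
zero (a, b, c) has c ≠ 0; the secant parametrisation of X² + D W² = C from (a/c, b/c) writes any
real zero as ν·M·(t², t, 1)ᵀ with M ∈ M₃(ℚ), det M = −4DC ≠ 0, so a zero with ℚ-independent log
coordinates yields the GP₃ (ν, νt, νt²) ∈ (𝓛∩ℝ)³ (x/z ≠ a/c by independence). Explicit algebra, ~300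
lines. [difficulty: provable-now] [arXiv:1110.0141, Roy1995]
#9 PythagoreanIffGP3 (support) — 'no Pythagorean triple of ℚ-independent real logs of algebraic
numbers' ⟺ RealGP3: (y₂ − y₀, 2y₁, y₂ + y₀) ↔ (y₀, y₁, y₂) is an invertible rational change of
variables between the cone x² + w² = z² and the cone y₁² = y₀y₂ preserving (𝓛∩ℝ)³ and
ℚ-independence. [difficulty: provable-now] [Roy1995]
#9 GP4 (support) — no four ℚ-linearly independent logarithms of algebraic numbers in geometric
progression (card T1): with s = x₁/x₀ apply the six exponentials theorem (tree THEOREM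
Literature.NumberTheory.Transcendental.six_exponentials_holds) to (x₀, x₀s) × (1, s, s²), whose six
exponentials are e^{x₀}, e^{x₁}, e^{x₂}, e^{x₁}, e^{x₂}, e^{x₃}. [difficulty: provable-now]
[Waldschmidt2005, Lang1966]
#9 RatioTranscendental (support) — the ratio of two ℚ-independent logarithms of algebraic numbers is
transcendental (so every GP₃ of logs has transcendental ratio; card (3)(i)): Gelfond–Schneider (tree
THEOREM gelfond_schneider_holds) with a = e^{x₀}, b = x₁/x₀. [difficulty: provable-now]
[Gelfond1934, Waldschmidt2005]
#9 RatioNotLogLinear (support) — under the strong six exponentials theorem (named fact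
Literature.Barriers.Schanuel.roy1992_strongSixExponentials, Waldschmidt2005 Thm 2.1 / Cor 2.4) the
ratio s of a GP₃ of logs is not in 𝓛̃: apply it to [[1, x₀, x₁],[s, x₁, x₂]] (rank 1; rows
ℚ̄-independent as s ∉ ℚ̄ by RatioTranscendental; columns by Baker, tree THEOREM baker_holds).
[difficulty: provable-now] [Waldschmidt2005, Roy1992]
#9 FlatLatticeCM (support) — FlatLatticeLogs for CM lattices (Re τ and |τ|² rational): μ = length of
(1,0) ∈ 𝓛, |m+nτ|² = f(m,n) a positive-definite RATIONAL form with f(1,0) = 1, and f takes a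
non-square rational value on ℤ² (integers W² − (dm+p₁)² = c₁ > 0 for all m is impossible), so μ√f ∈
𝓛 contradicts Gelfond–Schneider (gelfond_schneider_holds). [difficulty: provable-now] [Gelfond1934,
doi:10.2307/1970790]
#9 SchanuelGivesTarget (support) — Schanuel ⇒ X (kill direction). Via tree THEOREM
Literature.Barriers.Schanuel.algIndepLogarithms_of_schanuel: (X1) q₁(x,w) − C z² is a nonzero
polynomial vanishing at algebraically independent (x,w,z); (X2) with u a ℚ-basis of span{z_k : k ∈
{(1,0),(0,1),(1,1),(1,−1),(1,2)}} the relations z_k² = kᵀGk become identities of quadratic forms in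
ℚ[u]; z₍₁,₁₎² + z₍₁,₋₁₎² = 2a² + 2c² forces z₍₁,±₁₎ = rational rotations of (a ± c), and then
z₍₁,₂₎² has Gram determinant 12pq ≠ 0 unless G₁₂ = ±ac (det G = 0) or a ∥ c (G = c²·rational form,
all values squares ⇒ rank 1) — contradicting Im τ > 0. ~500 lines. [difficulty: M] [Waldschmidt2005,
arXiv:1110.0141]
#9 StrongFourExpGivesPDQ21 (support) — the strong four exponentials conjecture (Waldschmidt2005 Conj
1.5, inlined over Literature.Barriers.Schanuel.logLinearForms) ⇒ PDQ21 on all classes: parametrise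
the conic over ℚ(√C) from (√C, 0): (x, w, z) = ν(√C(Dt²−1), −2√C t, Dt²+1), so ν, νt, νt² ∈ 𝓛 + √C·𝓛
⊂ 𝓛̃ and [[ν, νt],[νt, νt²]] has rank 1; t ∉ ℚ̄ since x/z = √C(Dt²−1)/(Dt²+1) is transcendental
(RatioTranscendental). [difficulty: provable-now] [Waldschmidt2005]
#9 FourExpGivesRealGP3 (support) — the four exponentials conjecture (tree open statement
Literature.NumberTheory.Transcendental.FourExponentialsConjecture) ⇒ RealGP3, applied to x = (x₀,
x₁), y = (1, x₁/x₀): the four exponentials are e^{x₀}, e^{x₁}, e^{x₁}, e^{x₂}. Records the exact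
position RealGP3 ≤ four exponentials ≤ AlgIndepLogarithms. [difficulty: provable-now]
[Waldschmidt2005, Roy1995]

TWO-LAYER PLAN. Foreseen glued splits (none filed now): FlatLatticeLogs ⇐ FlatLatticeNonCM (τ not
imaginary quadratic) → FlatLatticeCM →
FlatLatticeLogs (k = 2; the CM child is already the support item); RealGP3 ⇐ [ratio ∈ 𝓛̃:
RatioNotLogLinear once
roy1992_strongSixExponentials is discharged in tree] → [ratio ∉ 𝓛̃: the residue] → RealGP3;
AnisotropicPDQ21 ⇐ per real
quadratic field K = ℚ(√C): 'no real GP₃ in 𝓛 + √C·𝓛 with 1, t, t² ℚ-independent' → AnisotropicPDQ21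
(k ≤ 3 by grouping
square classes only if a class-specific tool appears).

KILL CRITERIA. ¬RealGP3 (a geometric progression of three independent real logs), ¬AnisotropicPDQ21
or ¬FlatLatticeLogs (a log-lattice)
each closes the route `refuted:<Decl>` AND refutes Schanuel through SchanuelGivesTarget (they are
instances of
AlgIndepLogarithms) — hand the witness to the summit's negative side. A proof elsewhere of
FourExponentialsConjecture gives
RealGP3 in ten lines, of the strong four exponentials conjecture gives PDQ21
(StrongFourExpGivesPDQ21), of AlgIndepLogarithms
gives X outright — the route is then absorbed (close superseded). If a grounder finds
PDQ21/RealGP3-real or the log-lattice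
statement already in print (Roy–Waldschmidt 1995, acq-02353; Diaz JTNB 2007) the cruxes stay but the
novelty grade drops.

NOT DECOMPOSED YET. The geometric corollary itself ("a compact arithmetic quotient of real rank 2 is
not length-commensurable to an arithmetic
hyperbolic surface", conditional only on X1 or on X2) is not typable (no arithmetic lattices /
closed geodesics of locally
symmetric spaces in Lean) — recorded as a cite-fact request for P–R's length formula and Prop 7.1,
not an item. Also left
out: PDQ(a,b) for higher ranks and the quartic relations behind (N_i); the complex (non-real) GP₃
where Diaz-type conjugation
gives partial results; the bounded-degree refinement of FlatLatticeLogs (lengths of arithmetic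
surfaces are rational multiples
of logs of Salem numbers of degree ≤ 2[K:ℚ]); which further square classes ⟨1,D,−C⟩ occur for other
(G₁,G₂) pairs; p-adic
analogues (Leopoldt-type consumers, arXiv:2408.08178).

CHEAPEST FALSIFIER. Lookup first: does Roy–Waldschmidt, Proc. Japan Acad. 71 (1995)
(doi:10.3792/pjaa.71.151, paywalled here, acq-02353) or Diaz
JTNB 19 (2007) (doi:10.5802/jtnb.592) already state PDQ21 / real GP₃ / a lattice-of-logs statement,
or prove a case? (Expected:
their unconditional results need ≥ 5 variables, cf. Waldschmidt2005 Thm 2.11 needs l > m²; the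
ternary case is Roy's no-go.)
Second: a refuter shows that the finite truncations of FlatLatticeLogs reduce to single 2×2 rank-one
log matrices only — then
crux 3 is not more attackable than crux 2 and is re-ranked (not closed). Third (done here, rc 0):
all statements elaborate and
the assembly is proved by pure logic in Sketch.lean; the planner's Hilbert-symbol computation that
(A₂|B₂|G₂ vs A₁) give
anisotropic classes ⟨1,3,−2⟩, ⟨1,1,−3⟩, ⟨6,2,−1⟩ (all fail at p = 3) should be re-done by a grounder
— if wrong, only the
prose dichotomy changes, no item.

NUMBERS. Linear subgroup theorem range r(d+l) < dl: (d,l,r) = (2,2,1) fails (four exponentials, open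
since Schneider 1957),
(2,3,1) holds (six exponentials, THEOREM in tree); Waldschmidt2005 Thm 2.11 needs l > m²; geometric
progressions of logs:
length 4 impossible (theorem), length 3 open, ratio known transcendental (Gelfond–Schneider) and,
under strong six
exponentials, outside 𝓛̃; unconditional rank-one geometry: hyperbolic 2- and 3-manifolds
(doi:10.1215/s0012-7094-92-06508-2,
doi:10.1215/00127094-2008-045) need only Gelfond–Schneider; every P–R statement of real rank > 1 is
conditional
(arXiv:1307.1479 §6). Items at open: 14 (1 target, 3 cruxes, 9 supports, 1 assembly).

DEFINITION REQUESTS. None for the items (all inline over Mathlib: IsAlgebraic ℚ (Real.exp x),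
LinearIndependent ℚ, ‖m + nτ‖). Cite fact wanted
(filed after open): "fact: Prasad–Rapinchuk length formula λ_Γ(γ)² = Σ_α (log|α(γ)|)² = Σ_k s_k (log
χ_k(γ))² and Prop 7.1
(SC ⇒ (T_i)) with SC replaceable by AlgIndepLogarithms(real)" (arXiv:1110.0141 §7;
doi:10.1007/s10240-009-0019-6 Prop 8.5).
Literature wanted: doi:10.3792/pjaa.71.151 (acq-02353).

Novelty: Searches (2026-08-15): `lit search --source zbmath "quadratic relations between logarithms of
algebraic numbers"` (2: Roy–Waldschmidt 1995 = doi:10.3792/pjaa.71.151, not held → acq-02353); `lit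
search --source zbmath "weakly commensurable arithmetic groups"` (13: the P–R circle — IHES 2009,
arXiv:1110.0141, arXiv:1307.1479, arXiv:0809.2401, Garibaldi–Rapinchuk 2013,
Chernousov–Rapinchuk–Rapinchuk 2024, Meyer 2017, Bhagwat–Pisolkar–Rajan 2014 — none isolates a
fragment of SC); `lit search --source zbmath "four exponentials conjecture" --year-from 2005` (19:
Waldschmidt 2023 survey doi:10.1007/978-3-031-12244-6_39, Butler 2017 doi:10.1007/s11139-015-9728-2
(three/four exponentials, Diophantine approach), Habsieger 2007, Diaz 2007); `lit frontier Schanuel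
--since 2020` (30 rows, none on length spectra); `lit bridges Schanuel --cross any` (none relevant);
`lit galaxy search "length-commensurable locally symmetric spaces Schanuel conjecture" --star all`
(service saturated, 0 rows), `lit galaxy search "lengths of closed geodesics" --star pdf --mode
substring` (8, none relevant), `"in geometric progression" --star pdf` (0 relevant); READ:
arXiv:1110.0141 §1, §7 (Prop 7.1 and proof), arXiv:1307.1479 §6 (P–R: "we will only need …
logarithms are algebraically independent once linearly independent"; "no results in transcendental
number theory … expressions of this kind"), Waldschmidt2005 pp. 338–347 (Conj 1.5, Consequences
1.8–1.9, Thm 2.1, Cor 2.4, 2.7–2.9, Thm 2.11–Cor 2.14), Roy1995  [refs: 10.3792/pjaa.71.151, 10.1007/978-3-031-12244-6_39, 10.1007/s11139-015-9728-2, 1110.0141, 1307.1479, 0809.2401, doi:10.3792/pjaa.71.151, doi:10.1007/978-3-031-12244-6_39, doi:10.1007/s11139-015-9728-2, Waldschmidt2005, Roy1995]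

Barriers (technique_class: six-exponentials structural-rank linear-subgroup-theorem): - technique_class: six-exponentials structural-rank linear-subgroup-theorem
- Literature.Barriers.Schanuel.LinearSubgroupMethodLimit: NOT evaded for RealGP3 / AnisotropicPDQ21
— they live on Roy's surface xy = z² (roy1995_thm_3_4_holds: every linear local embedding gives
matrices outside the LST range 4r < d+l); declared open-problem cruxes. FlatLatticeLogs changes the
hypothesis class: one point of 𝓛^{ℤ²} on an infinite intersection of quadrics (a 3-parameter
family), whose finite truncations X_S ⊂ ℂ^S are 3-folds in growing ambient dimension — the regime
(like M_{2,l}(1), l ≥ 3) where LST numerology can turn favourable; the bet is that some truncation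
admits a linear embedding in range, or that lattice rigidity (parallelogram law at all k)
substitutes for it. It may not; then rank 3 is re-ranked below rank 2.
- Literature.Barriers.Schanuel.AlgebraicIndependenceOfLogarithms: strength barrier accepted by
design — X sits strictly below AlgIndepLogarithms (degree-2, ≤ 3 logs pointwise; SchanuelGivesTarget
records Schanuel ⇒ AlgIndepLogs ⇒ X), and the route measures a consumer's cost in these units
instead of claiming the summit.
- Literature.Barriers.Schanuel.LargeTranscendenceDegree: not applicable — no transcendence-degree ≥
2 output is claimed; all items are non-vanishing statements for one quadratic form.
- Literature.Barriers.Schanuel.NesterenkoModularScope,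
Literature.Barriers.Schanuel.EFunctionValuesAtAlgebraicPoints,
Literature.Barriers.Schanuel.PeriodConjectureOverQbar

History (route lifecycle, newest last):
- 2026-08-15T13:51:07Z · CLOSED retired — not-a-thesis: assembly does not conclude the sub-problem Statement (operator:999:1257524)

sub-problem: Schanuel · status: closed(retired) · opened planner-plancard-Schanuel-Schanuel-geodesic-l-d32465ca-0 2026-08-15T11:49:30Z · rev 1 · ledger route-Schanuel-GeodesicLengthsGP3
GENERATED by the gate from the ledger (D-0016/17). Provers cite these decls: `theorem foo : Summit.Schanuel.Schanuel.Theses.GeodesicLengthsGP3.<Decl> := …` in Summits/Schanuel/Schanuel/Theorems/<Name>.lean.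
-/

namespace Summit.Schanuel.Schanuel.Theses.GeodesicLengthsGP3

open scoped BigOperators Topology Manifold Classical MeasureTheory ProbabilityTheory Matrix InnerProductSpace ComplexConjugate ContinuousMap
open Filter Set Function TopologicalSpace MeasureTheory

attribute [summit_statement] _root_.Schanuel

open Literature.Periods

/-- item stmt-Schanuel-6643 · target · rank 0 · closed · moot by None · by planner
why it might fail: X is a conjunction of open four-exponentials-type statements strictly below AlgIndepLogarithms; it fails iff a rank-(2,1) length coincidence among independent real logs or a log-lattice exists — either refutes Schanuel.
sources: arXiv:1110.0141, arXiv:1307.1479, Waldschmidt2005, Roy1995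
[target] X = X1 ∧ X2 (PDQ21 ∧ FlatLatticeLogs) as in § Thesis: the pointwise rank-(2,1) input and
the flats-amplified input of the length-commensurability programme. -/
@[route_item "route-Schanuel-GeodesicLengthsGP3"]
def Target : Prop :=
  (∀ (D C : ℚ), 0 < D → 0 < C → ∀ x : Fin 3 → ℝ, LinearIndependent ℚ x → (∀ i, IsAlgebraic ℚ (Real.exp (x i))) → x 0 ^ 2 + (D : ℝ) * x 1 ^ 2 ≠ (C : ℝ) * x 2 ^ 2) ∧ (∀ (μ : ℝ) (τ : ℂ), 0 < μ → 0 < τ.im → ∃ m n : ℤ, ¬ IsAlgebraic ℚ (Real.exp (μ * ‖(m : ℂ) + (n : ℂ) * τ‖)))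

/-- item stmt-Schanuel-6644 · crux · rank 2 · closed · moot by None · by planner
why it might fail: It is the symmetric rank-one case [[λ₀,λ₁],[λ₁,λ₂]] of the four exponentials conjecture on Roy's no-go surface xy = z² (Roy1995 §3.2, Thm 3.4): no method known; false iff (log β)² = (log α)(log γ) for multiplicatively independent real algebraic α, β, γ.
sources: Roy1995, Waldschmidt2005, doi:10.1007/s11139-015-9728-2, doi:10.5486/pmd.2007.3505, doi:10.1007/978-3-031-12244-6_39
[crux] no three ℚ-linearly independent real logarithms of (real, positive) algebraic numbers are in
geometric progression: x₁² ≠ x₀x₂ (card C1; equivalently PDQ21 on every ℚ-isotropic class, e.g. no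
Pythagorean triple (log α)² + (log β)² = (log γ)² of independent real logs). Roy's no-go example xy
= z² restricted to real points; the symmetric rank-one case of the four exponentials conjecture.
Algebraic ratio excluded by Gelfond–Schneider, ratio in 𝓛̃ by strong six exponentials, length 4 by
six exponentials (supports). [difficulty: open-problem] -/
@[route_item "route-Schanuel-GeodesicLengthsGP3"]
def RealGP3 : Prop :=
  ∀ x : Fin 3 → ℝ, LinearIndependent ℚ x → (∀ i, IsAlgebraic ℚ (Real.exp (x i))) → x 1 ^ 2 ≠ x 0 * x 2

/-- item stmt-Schanuel-6645 · crux · rank 3 · closed · moot by None · by planner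
why it might fail: Any finite set of lengths only obeys diagonal quadratic relations (parallelogram law), each a 2×2 rank-one log matrix [[z₁−z₃, z₄−z₂],[z₄+z₂, z₁+z₃]] — four-exponentials-hard; nothing in print exploits infinitely many such relations; only CM lattices fall (Gelfond–Schneider).
sources: doi:10.2307/1970790, arXiv:1110.0141, Waldschmidt2005, Roy1995
[crux] for every scale μ > 0 and every τ in the upper half plane some lattice length μ|m + nτ|
((m,n) ∈ ℤ²) is not the logarithm of an algebraic number: no flat 2-torus has all its
closed-geodesic lengths in 𝓛 (card C2 'Q3C', flat form; via a compact 2-flat this alone forbids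
length-commensurability of a rank-2 arithmetic quotient with any space whose lengths are rational
multiples of logs of algebraic numbers). CM lattices (τ imaginary quadratic) are excluded by
Gelfond–Schneider (support FlatLatticeCM); AlgIndepLogarithms ⇒ the statement (support
SchanuelGivesTarget: five lengths k ∈ {(1,0),(0,1),(1,±1),(1,2)} already force a degenerate Gram
matrix). [difficulty: L] -/
@[route_item "route-Schanuel-GeodesicLengthsGP3"]
def FlatLatticeLogs : Prop :=
  ∀ (μ : ℝ) (τ : ℂ), 0 < μ → 0 < τ.im → ∃ m n : ℤ, ¬ IsAlgebraic ℚ (Real.exp (μ * ‖(m : ℂ) + (n : ℂ) * τ‖))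

/-- item stmt-Schanuel-6646 · crux · rank 4 · closed · moot by None · by planner
why it might fail: Over ℚ(√C) the conic parametrises into a GP₃ inside 𝓛 + √C·𝓛 ⊂ 𝓛̃, so this is a case of the STRONG four exponentials conjecture (Waldschmidt2005 Conj 1.5) on Roy's no-go surface, beyond even RealGP3; no partial result known for real entries.
sources: Waldschmidt2005, Roy1995, arXiv:1110.0141, doi:10.3792/pjaa.71.151
[crux] PDQ21 on the ℚ-ANISOTROPIC classes: if X² + D W² − C Z² (D, C ∈ ℚ_{>0}) has no nontrivial
rational zero, it has no zero (x, w, z) made of ℚ-linearly independent real logarithms of algebraic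
numbers. By the planner's Hilbert-symbol computation (to be re-grounded) the classes met by the
basic geometric pairs are all of this kind: type A₂ vs A₁ gives ⟨1,3,−2⟩, B₂ vs A₁ gives ⟨1,1,−3⟩,
G₂ vs A₁ gives ⟨6,2,−1⟩, each anisotropic at p = 3. [deps: RealGP3] [difficulty: open-problem] -/
@[route_item "route-Schanuel-GeodesicLengthsGP3"]
def AnisotropicPDQ21 : Prop :=
  ∀ (D C : ℚ), 0 < D → 0 < C → (∀ a b c : ℚ, a ^ 2 + D * b ^ 2 = C * c ^ 2 → a = 0 ∧ b = 0 ∧ c = 0) → ∀ x : Fin 3 → ℝ, LinearIndependent ℚ x → (∀ i, IsAlgebraic ℚ (Real.exp (x i))) → x 0 ^ 2 + (D : ℝ) * x 1 ^ 2 ≠ (C : ℝ) * x 2 ^ 2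

/-- item stmt-Schanuel-6647 · support · rank 9 · closed · moot by None · by planner
sources: arXiv:1110.0141, Roy1995
[support] RealGP3 ⇒ PDQ21 on every ℚ-isotropic class: a nontrivial rational zero (a, b, c) has c ≠
0; the secant parametrisation of X² + D W² = C from (a/c, b/c) writes any real zero as ν·M·(t², t,
1)ᵀ with M ∈ M₃(ℚ), det M = −4DC ≠ 0, so a zero with ℚ-independent log coordinates yields the GP₃
(ν, νt, νt²) ∈ (𝓛∩ℝ)³ (x/z ≠ a/c by independence). Explicit algebra, ~300 lines. [difficulty:
provable-now] -/
@[route_item "route-Schanuel-GeodesicLengthsGP3"]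
def IsotropicReduction : Prop :=
  (∀ x : Fin 3 → ℝ, LinearIndependent ℚ x → (∀ i, IsAlgebraic ℚ (Real.exp (x i))) → x 1 ^ 2 ≠ x 0 * x 2) → ∀ (D C : ℚ), 0 < D → 0 < C → (∃ a b c : ℚ, (a ≠ 0 ∨ b ≠ 0 ∨ c ≠ 0) ∧ a ^ 2 + D * b ^ 2 = C * c ^ 2) → ∀ x : Fin 3 → ℝ, LinearIndependent ℚ x → (∀ i, IsAlgebraic ℚ (Real.exp (x i))) → x 0 ^ 2 + (D : ℝ) * x 1 ^ 2 ≠ (C : ℝ) * x 2 ^ 2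

/-- item stmt-Schanuel-6648 · support · rank 9 · closed · moot by None · by planner
sources: Roy1995
[support] 'no Pythagorean triple of ℚ-independent real logs of algebraic numbers' ⟺ RealGP3: (y₂ −
y₀, 2y₁, y₂ + y₀) ↔ (y₀, y₁, y₂) is an invertible rational change of variables between the cone x² +
w² = z² and the cone y₁² = y₀y₂ preserving (𝓛∩ℝ)³ and ℚ-independence. [difficulty: provable-now] -/
@[route_item "route-Schanuel-GeodesicLengthsGP3"]
def PythagoreanIffGP3 : Prop :=
  (∀ x : Fin 3 → ℝ, LinearIndependent ℚ x → (∀ i, IsAlgebraic ℚ (Real.exp (x i))) → x 0 ^ 2 + x 1 ^ 2 ≠ x 2 ^ 2) ↔ (∀ x : Fin 3 → ℝ, LinearIndependent ℚ x → (∀ i, IsAlgebraic ℚ (Real.exp (x i))) → x 1 ^ 2 ≠ x 0 * x 2)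

/-- item stmt-Schanuel-6649 · support · rank 9 · closed · moot by None · by planner
sources: Waldschmidt2005, Lang1966
[support] no four ℚ-linearly independent logarithms of algebraic numbers in geometric progression
(card T1): with s = x₁/x₀ apply the six exponentials theorem (tree THEOREM
Literature.NumberTheory.Transcendental.six_exponentials_holds) to (x₀, x₀s) × (1, s, s²), whose six
exponentials are e^{x₀}, e^{x₁}, e^{x₂}, e^{x₁}, e^{x₂}, e^{x₃}. [difficulty: provable-now] -/
@[route_item "route-Schanuel-GeodesicLengthsGP3"]
def GP4 : Prop :=
  ∀ x : Fin 4 → ℂ, LinearIndependent ℚ x → (∀ i, IsAlgebraic ℚ (Complex.exp (x i))) → ¬ (x 1 ^ 2 = x 0 * x 2 ∧ x 2 ^ 2 = x 1 * x 3)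

/-- item stmt-Schanuel-6650 · support · rank 9 · closed · moot by None · by planner
sources: Gelfond1934, Waldschmidt2005
[support] the ratio of two ℚ-independent logarithms of algebraic numbers is transcendental (so every
GP₃ of logs has transcendental ratio; card (3)(i)): Gelfond–Schneider (tree THEOREM
gelfond_schneider_holds) with a = e^{x₀}, b = x₁/x₀. [difficulty: provable-now] -/
@[route_item "route-Schanuel-GeodesicLengthsGP3"]
def RatioTranscendental : Prop :=
  ∀ x : Fin 2 → ℂ, LinearIndependent ℚ x → (∀ i, IsAlgebraic ℚ (Complex.exp (x i))) → Transcendental ℚ (x 1 / x 0)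

/-- item stmt-Schanuel-6651 · support · rank 9 · closed · moot by None · by planner
sources: Waldschmidt2005, Roy1992
[support] under the strong six exponentials theorem (named fact
Literature.Barriers.Schanuel.roy1992_strongSixExponentials, Waldschmidt2005 Thm 2.1 / Cor 2.4) the
ratio s of a GP₃ of logs is not in 𝓛̃: apply it to [[1, x₀, x₁],[s, x₁, x₂]] (rank 1; rows
ℚ̄-independent as s ∉ ℚ̄ by RatioTranscendental; columns by Baker, tree THEOREM baker_holds).
[difficulty: provable-now] -/
@[route_item "route-Schanuel-GeodesicLengthsGP3"]
def RatioNotLogLinear : Prop :=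
  Literature.Barriers.Schanuel.roy1992_strongSixExponentials → ∀ x : Fin 3 → ℂ, LinearIndependent ℚ x → (∀ i, IsAlgebraic ℚ (Complex.exp (x i))) → x 1 ^ 2 = x 0 * x 2 → x 1 / x 0 ∉ Literature.Barriers.Schanuel.logLinearForms

/-- item stmt-Schanuel-6652 · support · rank 9 · closed · moot by None · by planner
sources: Gelfond1934, doi:10.2307/1970790
[support] FlatLatticeLogs for CM lattices (Re τ and |τ|² rational): μ = length of (1,0) ∈ 𝓛, |m+nτ|²
= f(m,n) a positive-definite RATIONAL form with f(1,0) = 1, and f takes a non-square rational value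
on ℤ² (integers W² − (dm+p₁)² = c₁ > 0 for all m is impossible), so μ√f ∈ 𝓛 contradicts
Gelfond–Schneider (gelfond_schneider_holds). [difficulty: provable-now] -/
@[route_item "route-Schanuel-GeodesicLengthsGP3"]
def FlatLatticeCM : Prop :=
  ∀ (μ : ℝ) (τ : ℂ), 0 < μ → 0 < τ.im → (∃ p q : ℚ, τ.re = p ∧ Complex.normSq τ = q) → ∃ m n : ℤ, ¬ IsAlgebraic ℚ (Real.exp (μ * ‖(m : ℂ) + (n : ℂ) * τ‖))

/-- item stmt-Schanuel-6653 · support · rank 9 · closed · moot by None · by planner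
sources: Waldschmidt2005, arXiv:1110.0141
[support] Schanuel ⇒ X (kill direction). Via tree THEOREM
Literature.Barriers.Schanuel.algIndepLogarithms_of_schanuel: (X1) q₁(x,w) − C z² is a nonzero
polynomial vanishing at algebraically independent (x,w,z); (X2) with u a ℚ-basis of span{z_k : k ∈
{(1,0),(0,1),(1,1),(1,−1),(1,2)}} the relations z_k² = kᵀGk become identities of quadratic forms in
ℚ[u]; z₍₁,₁₎² + z₍₁,₋₁₎² = 2a² + 2c² forces z₍₁,±₁₎ = rational rotations of (a ± c), and then
z₍₁,₂₎² has Gram determinant 12pq ≠ 0 unless G₁₂ = ±ac (det G = 0) or a ∥ c (G = c²·rational form,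
all values squares ⇒ rank 1) — contradicting Im τ > 0. ~500 lines. [difficulty: M] -/
@[route_item "route-Schanuel-GeodesicLengthsGP3"]
def SchanuelGivesTarget : Prop :=
  Schanuel → (∀ (D C : ℚ), 0 < D → 0 < C → ∀ x : Fin 3 → ℝ, LinearIndependent ℚ x → (∀ i, IsAlgebraic ℚ (Real.exp (x i))) → x 0 ^ 2 + (D : ℝ) * x 1 ^ 2 ≠ (C : ℝ) * x 2 ^ 2) ∧ (∀ (μ : ℝ) (τ : ℂ), 0 < μ → 0 < τ.im → ∃ m n : ℤ, ¬ IsAlgebraic ℚ (Real.exp (μ * ‖(m : ℂ) + (n : ℂ) * τ‖)))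

/-- item stmt-Schanuel-6654 · support · rank 9 · closed · moot by None · by planner
sources: Waldschmidt2005
[support] the strong four exponentials conjecture (Waldschmidt2005 Conj 1.5, inlined over
Literature.Barriers.Schanuel.logLinearForms) ⇒ PDQ21 on all classes: parametrise the conic over
ℚ(√C) from (√C, 0): (x, w, z) = ν(√C(Dt²−1), −2√C t, Dt²+1), so ν, νt, νt² ∈ 𝓛 + √C·𝓛 ⊂ 𝓛̃ and [[ν,
νt],[νt, νt²]] has rank 1; t ∉ ℚ̄ since x/z = √C(Dt²−1)/(Dt²+1) is transcendental
(RatioTranscendental). [difficulty: provable-now] -/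
@[route_item "route-Schanuel-GeodesicLengthsGP3"]
def StrongFourExpGivesPDQ21 : Prop :=
  (∀ M : Matrix (Fin 2) (Fin 2) ℂ, (∀ i j, M i j ∈ Literature.Barriers.Schanuel.logLinearForms) → LinearIndependent (algebraicClosure ℚ ℂ) (fun i => M i) → LinearIndependent (algebraicClosure ℚ ℂ) (fun j => M.transpose j) → M.rank = 2) → ∀ (D C : ℚ), 0 < D → 0 < C → ∀ x : Fin 3 → ℝ, LinearIndependent ℚ x → (∀ i, IsAlgebraic ℚ (Real.exp (x i))) → x 0 ^ 2 + (D : ℝ) * x 1 ^ 2 ≠ (C : ℝ) * x 2 ^ 2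

/-- item stmt-Schanuel-6655 · support · rank 9 · closed · moot by None · by planner
sources: Waldschmidt2005, Roy1995
[support] the four exponentials conjecture (tree open statement
Literature.NumberTheory.Transcendental.FourExponentialsConjecture) ⇒ RealGP3, applied to x = (x₀,
x₁), y = (1, x₁/x₀): the four exponentials are e^{x₀}, e^{x₁}, e^{x₁}, e^{x₂}. Records the exact
position RealGP3 ≤ four exponentials ≤ AlgIndepLogarithms. [difficulty: provable-now] -/
@[route_item "route-Schanuel-GeodesicLengthsGP3"]
def FourExpGivesRealGP3 : Prop :=
  Literature.NumberTheory.Transcendental.FourExponentialsConjecture → ∀ x : Fin 3 → ℝ, LinearIndependent ℚ x → (∀ i, IsAlgebraic ℚ (Real.exp (x i))) → x 1 ^ 2 ≠ x 0 * x 2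

/-- item stmt-Schanuel-6656 · assembly · rank 1 · closed · moot by None · by planner
sources: arXiv:1110.0141, Waldschmidt2005
[assembly] RealGP3 → AnisotropicPDQ21 → IsotropicReduction → FlatLatticeLogs → Target (X1 ∧ X2). -/
@[route_item "route-Schanuel-GeodesicLengthsGP3"]
def Assembly : Prop :=
  (∀ x : Fin 3 → ℝ, LinearIndependent ℚ x → (∀ i, IsAlgebraic ℚ (Real.exp (x i))) → x 1 ^ 2 ≠ x 0 * x 2) → (∀ (D C : ℚ), 0 < D → 0 < C → (∀ a b c : ℚ, a ^ 2 + D * b ^ 2 = C * c ^ 2 → a = 0 ∧ b = 0 ∧ c = 0) → ∀ x : Fin 3 → ℝ, LinearIndependent ℚ x → (∀ i, IsAlgebraic ℚ (Real.exp (x i))) → x 0 ^ 2 + (D : ℝ) * x 1 ^ 2 ≠ (C : ℝ) * x 2 ^ 2) → ((∀ x : Fin 3 → ℝ, LinearIndependent ℚ x → (∀ i, IsAlgebraic ℚ (Real.exp (x i))) → x 1 ^ 2 ≠ x 0 * x 2) → ∀ (D C : ℚ), 0 < D → 0 < C → (∃ a b c : ℚ, (a ≠ 0 ∨ b ≠ 0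 ∨ c ≠ 0) ∧ a ^ 2 + D * b ^ 2 = C * c ^ 2) → ∀ x : Fin 3 → ℝ, LinearIndependent ℚ x → (∀ i, IsAlgebraic ℚ (Real.exp (x i))) → x 0 ^ 2 + (D : ℝ) * x 1 ^ 2 ≠ (C : ℝ) * x 2 ^ 2) → (∀ (μ : ℝ) (τ : ℂ), 0 < μ → 0 < τ.im → ∃ m n : ℤ, ¬ IsAlgebraic ℚ (Real.exp (μ * ‖(m : ℂ) + (n : ℂ) * τ‖))) → ((∀ (D C : ℚ), 0 < D → 0 < C → ∀ x : Fin 3 → ℝ, LinearIndependent ℚ x → (∀ i, IsAlgebraic ℚ (Real.exp (x i))) → x 0 ^ 2 + (D : ℝ) * x 1 ^ 2 ≠ (C : ℝ) * x 2 ^ 2) ∧ (∀ (μ : ℝ) (τ : ℂ), 0 < μ → 0 < τ.im → ∃ m n : ℤ, ¬ IsAlgebraic ℚ (Real.exp (μ * ‖(m : ℂ) + (n : ℂ) * τ‖))))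

end Summit.Schanuel.Schanuel.Theses.GeodesicLengthsGP3
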